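import Summits.ValiantsHypothesis.ValiantsHypothesis.Theorems.SymPencilSdcPerFourTwentySeven
import Summits.ValiantsHypothesis.ValiantsHypothesis.Theorems.SymPencilPerFourCrossSevenEight
import Summits.ValiantsHypothesis.ValiantsHypothesis.Theorems.SymPencilPerFourJointFamilyTransport

/-!
# Route `SymPencil` — cell `(9, 7, 8)` of the size-`27` kernel-package table is EMPTY modulo
# ONE inner-rank hypothesis on detecting-pair spaces (`--supports` stmt-ValiantsHypothesis-5674
# `SdcSuperquadratic`; rung currency only — nothing here bears on `VP ≠ VNP`)

In the base-point package of a symmetric affine determinantal representation of `per_4` of size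
`m ≤ 27` over a field of characteristic `0`
(`SymPencilPerFourBasePointPackage.basepoint_package_of_isSymm_isAffineDetRepr_perPoly_four`)
with a `9`-dimensional space of kernel rows, the kernel `V = ker bL` is a `7`-dimensional subspace
of `Sing Z(per_4)` carrying a JOINT family of `8` squares
(`SymPencilIsotropicKernelSquaresBilinear.sum_sq_of_isotropic_defect_bilinear`, defect
`26 - 2·9 = 8`).  By `SymPencilBoxFourSeven.seven_trichotomy`, `V` has a detecting pair of rows,
or of columns, or lies in a cross `X_{lc}`; the cross branch is dead
(`SymPencilPerFourCrossSevenEight.not_sqFamilySwap_eight_of_cross_seven`, val-width-5674-w2 g0′),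
and the column branch is the transpose of the row branch
(`SymPencilPerFourJointFamilyTransport.jointFamily_map_transpose`).

**Theorem** (`false_of_rank_nine_le_twentySeven_of_H978`): the cell `(9, 7, 8)` is empty GIVEN the
hypothesis **H978** — «no `7`-dimensional `W ⊆ Sing Z(per_4)` with a DETECTING PAIR OF ROWS
(`x ∈ W`, `x_{p·} = x_{q·} = 0 ⇒ x = 0`) carries a joint family of `8` squares» — stated here as an
explicit Lean hypothesis (the inner-rank question «inner rank ≥ 9 on `7`-dimensional two-row-type
spaces» of `Cruxes/SdcSuperquadratic/CELLS-27.md` § (9,7,8)).  This PINS the missing lemma of the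
cell by name and signature; H978 itself is OPEN.

Honest framing: a CONDITIONAL closing of one cell; the cells `(8,8,10)`, `(11,5,4)`, `(12,4,2)` and
H978 remain; the window `27 ≤ sdc(per₄) ≤ 29` is UNCHANGED; stmt-5674 `SdcSuperquadratic` stays
OPEN; `VP ≠ VNP` is not moved; no summit statement is proved here.  No definitions, no named facts.
[folklore]
-/

noncomputable section

-- single-conjunct layout: Sub = Summit, duplicated namespace component intended
set_option linter.dupNamespace false

namespace Summit.ValiantsHypothesis.ValiantsHypothesis.Theorems.SymPencilSdcPerFourCellNineSeven

open Matrix MvPolynomial Module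
open Literature.Computability.AlgebraicComplexity
open Summit.ValiantsHypothesis.ValiantsHypothesis.Theorems.SymPencilIsotropicKernelSquaresBilinear
open Summit.ValiantsHypothesis.ValiantsHypothesis.Theorems.SymPencilBoxFourEquality
open Summit.ValiantsHypothesis.ValiantsHypothesis.Theorems.SymPencilBoxFourSeven
open Summit.ValiantsHypothesis.ValiantsHypothesis.Theorems.SymPencilPerFourCrossSevenEight
open Summit.ValiantsHypothesis.ValiantsHypothesis.Theorems.SymPencilPerFourJointFamilyTransport

universe u

variable {K : Type u} [Field K]

/-- **Transpose of a detecting-COLUMN space is a detecting-ROW space**, with singularity and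
dimension preserved. [folklore] -/
theorem transpose_detecting [CharZero K] (V : Submodule K (Fin 4 × Fin 4 → K))
    (hV : ∀ x ∈ V, ∀ (r c : Fin 3 → Fin 4), Function.Injective r → Function.Injective c →
      ((Matrix.of fun i j => x (i, j)).submatrix r c).permanent = 0)
    (h7 : finrank K V = 7) {p q : Fin 4}
    (hdet : ∀ x ∈ V, (∀ i, x (i, p) = 0) → (∀ i, x (i, q) = 0) → x = 0) :
    let V' := V.map (LinearEquiv.funCongrLeft K K (Equiv.prodComm (Fin 4) (Fin 4))).toLinearMap
    (∀ x ∈ V', ∀ (r c : Fin 3 → Fin 4), Function.Injective r → Function.Injective c →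
      ((Matrix.of fun i j => x (i, j)).submatrix r c).permanent = 0) ∧
    finrank K V' = 7 ∧
    (∀ x ∈ V', (∀ j, x (p, j) = 0) → (∀ j, x (q, j) = 0) → x = 0) := by
  intro V'
  have hΦ : ∀ (x : Fin 4 × Fin 4 → K) (i j : Fin 4),
      (LinearEquiv.funCongrLeft K K (Equiv.prodComm (Fin 4) (Fin 4))) x (i, j) = x (j, i) :=
    fun x i j => rfl
  refine ⟨?_, ?_, ?_⟩
  · rintro _ ⟨x, hx, rfl⟩ r c hr hc
    have h := hV x hx c r hc hr
    rw [← Matrix.permanent_transpose] at h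
    have e : ((Matrix.of fun i j => x (i, j)).submatrix c r)ᵀ =
        (Matrix.of fun i j =>
          (LinearEquiv.funCongrLeft K K (Equiv.prodComm (Fin 4) (Fin 4))).toLinearMap x (i, j)).submatrix
          r c := by
      ext i j
      rfl
    rw [e] at h
    exact h
  · rw [LinearEquiv.finrank_map_eq, h7]
  · rintro _ ⟨x, hx, rfl⟩ hp hq
    have hx0 : x = 0 := hdet x hx (fun i => hp i) (fun i => hq i)
    rw [hx0, map_zero]

/-- **Cell `(9, 7, 8)` is empty modulo H978.**  See the module docstring. [folklore] -/
theorem false_of_rank_nine_le_twentySeven_of_H978 (K : Type*) [Field K] [CharZero K]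
    {m : ℕ} (hm : m ≤ 27)
    {i₀ : Fin m} {D : Matrix {i // i ≠ i₀} {i // i ≠ i₀} K}
    {bL : (Fin 4 × Fin 4 → K) →ₗ[K] ({i // i ≠ i₀} → K)}
    {CL : (Fin 4 × Fin 4 → K) →ₗ[K] Matrix {i // i ≠ i₀} {i // i ≠ i₀} K} {κ : K}
    (hD : IsUnit D.det) (hDs : Dᵀ = D) (hCs : ∀ z, (CL z)ᵀ = CL z) (hκ : κ ≠ 0)
    (hi : ∀ z, bL z ⬝ᵥ D⁻¹ *ᵥ bL z = 0)
    (hii : ∀ z, bL z ⬝ᵥ (D⁻¹ * CL z * D⁻¹) *ᵥ bL z = 0)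
    (hiii : ∀ z, D.det * (bL z ⬝ᵥ (D⁻¹ * CL z * D⁻¹ * CL z * D⁻¹) *ᵥ bL z) =
      -(κ * eval z (perPoly (Fin 4) K)))
    (hV4 : ∀ x ∈ LinearMap.ker bL, ∀ r c : Fin 4,
      ((Matrix.of fun i j => x (i, j)).submatrix r.succAbove c.succAbove).permanent = 0)
    (hcard : Fintype.card {i // i ≠ i₀} + 1 = m)
    (hrn : finrank K (LinearMap.range bL) + finrank K (LinearMap.ker bL) = 16)
    (H978 : ∀ W : Submodule K (Fin 4 × Fin 4 → K),
      (∀ x ∈ W, ∀ (r c : Fin 3 → Fin 4), Function.Injective r → Function.Injective c →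
        ((Matrix.of fun i j => x (i, j)).submatrix r c).permanent = 0) →
      finrank K W = 7 → ∀ p q : Fin 4, p ≠ q →
      (∀ x ∈ W, (∀ j, x (p, j) = 0) → (∀ j, x (q, j) = 0) → x = 0) →
      ∀ (c : Fin 8 → K) (β : Fin 8 → ((Fin 4 × Fin 4 → K) →ₗ[K] (Fin 4 × Fin 4 → K) →ₗ[K] K)),
      ¬ (∀ u : Fin 4 × Fin 4 → K, ∀ y ∈ W, ∃ e₀ e₁ : K, ∀ s : K,
          eval (u + s • y) (perPoly (Fin 4) K) = e₀ + s * e₁ + s ^ 2 * ∑ k, c k * (β k u y) ^ 2))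
    (h9 : finrank K (LinearMap.range bL) = 9) : False := by
  classical
  have hk7 : finrank K (LinearMap.ker bL) = 7 := by omega
  -- the joint family of `8` squares along the kernel
  obtain ⟨c, β, hcβ⟩ := sum_sq_of_isotropic_defect_bilinear hD hDs bL CL hCs
    (fun z => eval z (perPoly (Fin 4) K)) hκ hi hii hiii 8 (by omega)
  set V := LinearMap.ker bL with hVdef
  have hfam : ∀ u : Fin 4 × Fin 4 → K, ∀ y ∈ V, ∃ e₀ e₁ : K, ∀ s : K,
      eval (u + s • y) (perPoly (Fin 4) K) = e₀ + s * e₁ + s ^ 2 * ∑ k, c k * (β k u y) ^ 2 :=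
    fun u y hy => hcβ u y (LinearMap.mem_ker.1 hy)
  have hV3 : ∀ x ∈ V, ∀ (r c : Fin 3 → Fin 4), Function.Injective r → Function.Injective c →
      ((Matrix.of fun i j => x (i, j)).submatrix r c).permanent = 0 :=
    fun x hx r c hr hc => subperm_vanish_inj_of_succAbove x (hV4 x hx) r c hr hc
  rcases seven_trichotomy V hV3 hk7 with ⟨p, q, hpq, hdet⟩ | ⟨p, q, hpq, hdet⟩ | ⟨l, c', hX⟩
  · -- detecting rows
    exact H978 V hV3 hk7 p q hpq hdet c β hfam
  · -- detecting columns: transpose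
    obtain ⟨hV3', h7', hdet'⟩ := transpose_detecting V hV3 hk7 hdet
    obtain ⟨c'', β', hfam'⟩ := jointFamily_map_transpose V c β hfam
    exact H978 _ hV3' h7' p q hpq hdet' c'' β' hfam'
  · -- cross: dead by `SymPencilPerFourCrossSevenEight`
    exact not_sqFamilySwap_eight_of_cross_seven V ⟨l, c', hX⟩ hk7 fun y hy =>
      ⟨c, fun k => (β k).flip y, fun u => by
        obtain ⟨e₀, e₁, he⟩ := hfam u y hy
        exact ⟨e₀, e₁, fun s => by simpa only [LinearMap.flip_apply] using he s⟩⟩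

end Summit.ValiantsHypothesis.ValiantsHypothesis.Theorems.SymPencilSdcPerFourCellNineSeven

end
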